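import Mathlib
import HarnessLib

/-!
# Denominators of the binomial coefficients `C(a/N, k)` divide a power of `N`

For integers `a` and `N ≥ 1` and every `k`, the generalized binomial coefficient
`C(a/N, k) = (a/N)(a/N − 1)⋯(a/N − k + 1)/k!` lies in `ℤ[1/N]`: its denominator divides a power of
`N`. Equivalently, the binomial series `(1 + u)^{a/N} = Σₖ C(a/N, k) uᵏ` has coefficients in
`ℤ[1/N]`, and `((1 + u)^{1/N})ᴺ = 1 + u`. This is the classical integrality behind Eisenstein's
theorem on algebraic power series in the simplest (Kummer) case, and it is the step
"`x := (λ(τ)/16)^{1/N} ∈ t + t² ℤ[1/N]⟦t⟧`, with the Kummer integrality condition `x^N ∈ ℤ⟦q⟧`"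
in Calegari–Dimitrov–Tang's proof of the unbounded denominators conjecture (F. Calegari,
V. Dimitrov, Y. Tang, J. Amer. Math. Soc. **38** (2025), arXiv:2109.09040, proof of Proposition 15,
display (xt)): if `x(q) = q (1 + q y(q))` with `y ∈ ℤ⟦q⟧` then
`x^{1/N} = t (1 + tᴺ y(tᴺ))^{1/N}`, `t = q^{1/N}`.

Proof (standard, `p`-adic): for a prime `p ∤ N`, `a/N` lies in the binomial ring `ℤₚ` (Mathlib
`PadicInt.instBinomialRing`), binomial coefficients commute with ring homomorphisms
(`Ring.map_choose`), so `‖C(a/N, k)‖ₚ ≤ 1`; a rational number which is a `p`-adic integer for all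
`p ∤ N` has denominator `d` with all prime factors dividing `N`, hence `d ∣ Nᵈ`.

## Contents (theorems only; no definitions, no named facts)

* `padicNorm_choose_div_natCast_le_one` — `‖C(a/N, k)‖ₚ ≤ 1` for `p ∤ N`.
* `not_dvd_den_of_padicNorm_le_one`, `dvd_pow_self_of_forall_prime_dvd` — the two arithmetic
  steps.
* `exists_choose_div_natCast_eq_div_pow` — `C(a/N, k) = z / Nᵐ` for some `z : ℤ`, `m : ℕ`.
* `exists_coeff_binomialSeries_div_natCast_eq_div_pow` — the same for the coefficients of
  Mathlib's `PowerSeries.binomialSeries ℚ (a/N)`.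
* `binomialSeries_nsmul`, `binomialSeries_inv_natCast_pow` — `(1+X)^{n r} = ((1+X)^r)ⁿ` and
  `((1 + X)^{1/N})ᴺ = 1 + X`.
* `exists_root_series_of_mem_X_add_X_sq` — CDT's display (xt) formally: every
  `x₀ ∈ q + q²ℤ⟦q⟧` has an `N`-th root `x(t) ∈ t + t²ℤ[1/N]⟦t⟧` of `x₀(tᴺ)`.

## References

* [CalegariDimitrovTang2025] arXiv:2109.09040, §3, proof of Proposition 15, display (xt)
  ("`x := (λ(τ)/16)^{1/N} ∈ t + t² ℤ[1/N]⟦t⟧`").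
* G. Eisenstein (1852) / E. Heine; see e.g. Y. Amice, *Les nombres p-adiques*, PUF (1975),
  for the `p`-adic integrality of binomial coefficients of `p`-adic integers.
-/

noncomputable section

namespace Literature.RingTheory.Binomial

open PowerSeries

/-! ### `p`-adic integrality -/

/-- For a prime `p` not dividing `N`, the binomial coefficient `C(a/N, k)` is a `p`-adic integer:
`a/N ∈ ℤₚ` is an element of a binomial ring (Mathlib `PadicInt.instBinomialRing`) and `Ring.choose`
commutes with the ring maps `ℤₚ → ℚₚ ← ℚ` (`Ring.map_choose`). [folklore] -/
theorem padicNorm_choose_div_natCast_le_one (p : ℕ) [Fact p.Prime] {N : ℕ} (hpN : ¬ p ∣ N)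
    (a : ℤ) (k : ℕ) : ‖((Ring.choose ((a : ℚ) / N) k : ℚ) : ℚ_[p])‖ ≤ 1 := by
  -- `N` is a unit of `ℤ_[p]`
  have hNunit : IsUnit (N : ℤ_[p]) := by
    rw [PadicInt.isUnit_iff, PadicInt.norm_natCast_eq_one_iff]
    exact (Nat.Prime.coprime_iff_not_dvd Fact.out).mpr hpN
  obtain ⟨u, hu⟩ := hNunit
  -- the `p`-adic integer `c = a / N`
  set c : ℤ_[p] := (a : ℤ_[p]) * ↑u⁻¹ with hc
  have hcq : ((c : ℤ_[p]) : ℚ_[p]) = (((a : ℚ) / N : ℚ) : ℚ_[p]) := by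
    have huinv : ((↑u⁻¹ : ℤ_[p]) : ℚ_[p]) = ((N : ℚ_[p]))⁻¹ := by
      refine eq_inv_of_mul_eq_one_left ?_
      rw [← PadicInt.coe_natCast, ← hu, ← PadicInt.coe_mul, Units.inv_mul, PadicInt.coe_one]
    rw [hc, PadicInt.coe_mul, huinv]
    push_cast
    rw [div_eq_mul_inv]
  have h1 : ((Ring.choose ((a : ℚ) / N) k : ℚ) : ℚ_[p]) =
      Ring.choose ((((a : ℚ) / N : ℚ) : ℚ_[p])) k :=
    Ring.map_choose (Rat.castHom ℚ_[p]) _ k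
  have h2 : ((Ring.choose c k : ℤ_[p]) : ℚ_[p]) = Ring.choose ((c : ℤ_[p]) : ℚ_[p]) k :=
    Ring.map_choose PadicInt.Coe.ringHom c k
  rw [h1, ← hcq, ← h2]
  exact PadicInt.norm_le_one _

/-! ### From `p`-adic integrality to denominators -/

/-- A rational number which is a `p`-adic integer has denominator prime to `p`. [folklore] -/
theorem not_dvd_den_of_padicNorm_le_one (p : ℕ) [Fact p.Prime] {q : ℚ}
    (h : ‖(q : ℚ_[p])‖ ≤ 1) : ¬ p ∣ q.den := by
  have hu : ‖(q.den : ℤ_[p])‖ = 1 := PadicInt.isUnit_iff.mp (PadicInt.isUnit_den q h)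
  rw [PadicInt.norm_natCast_eq_one_iff] at hu
  exact (Nat.Prime.coprime_iff_not_dvd Fact.out).mp hu

/-- If every prime factor of `d ≠ 0` divides `N`, then `d ∣ N ^ d`. [folklore] -/
theorem dvd_pow_self_of_forall_prime_dvd {d N : ℕ} (hd : d ≠ 0)
    (h : ∀ p : ℕ, p.Prime → p ∣ d → p ∣ N) : d ∣ N ^ d := by
  rcases Nat.eq_zero_or_pos N with rfl | hN
  · rw [zero_pow hd]
    exact dvd_zero d
  rw [← Nat.factorization_le_iff_dvd hd (pow_ne_zero d hN.ne'), Nat.factorization_pow]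
  intro p
  rw [Finsupp.smul_apply, smul_eq_mul]
  by_cases hp : p ∈ d.primeFactors
  · have hpp : p.Prime := Nat.prime_of_mem_primeFactors hp
    have hpN : 1 ≤ N.factorization p :=
      (hpp.dvd_iff_one_le_factorization hN.ne').mp (h p hpp (Nat.dvd_of_mem_primeFactors hp))
    calc d.factorization p ≤ d := (Nat.factorization_lt p hd).le
      _ ≤ d * N.factorization p := Nat.le_mul_of_pos_right d hpN
  · rw [Finsupp.notMem_support_iff.mp hp]
    exact Nat.zero_le _

/-- A rational number which is a `p`-adic integer for every prime `p ∤ N` (`N ≠ 0`) has the form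
`z / N ^ m` with `z ∈ ℤ`. [folklore] -/
theorem exists_eq_div_pow_of_forall_padicNorm_le_one {N : ℕ} (hN : N ≠ 0) {q : ℚ}
    (h : ∀ p : ℕ, ∀ [Fact p.Prime], ¬ p ∣ N → ‖(q : ℚ_[p])‖ ≤ 1) :
    ∃ (m : ℕ) (z : ℤ), q = z / (N : ℚ) ^ m := by
  -- every prime factor of `q.den` divides `N`
  have hden : ∀ p : ℕ, p.Prime → p ∣ q.den → p ∣ N := by
    intro p hp hpd
    by_contra hpN
    haveI : Fact p.Prime := ⟨hp⟩
    exact not_dvd_den_of_padicNorm_le_one p (h p hpN) hpd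
  obtain ⟨c, hc⟩ := dvd_pow_self_of_forall_prime_dvd q.den_nz hden
  refine ⟨q.den, q.num * c, ?_⟩
  have hd0 : (q.den : ℚ) ≠ 0 := by exact_mod_cast q.den_nz
  have hNpow : ((N : ℚ)) ^ q.den = (q.den : ℚ) * c := by exact_mod_cast hc
  rw [hNpow, Int.cast_mul, Int.cast_natCast, mul_div_mul_right _ _ (by
    intro hc0
    have : (N : ℚ) ^ q.den = 0 := by rw [hNpow, hc0, mul_zero]
    exact pow_ne_zero _ (Nat.cast_ne_zero.mpr hN) this)]
  exact (Rat.num_div_den q).symm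

/-- **Denominators of `C(a/N, k)`.** For `N ≠ 0`, `a ∈ ℤ` and every `k`, the binomial coefficient
`C(a/N, k) ∈ ℚ` equals `z / N ^ m` for some `z ∈ ℤ`, `m ∈ ℕ`, i.e. lies in `ℤ[1/N]` (the Kummer
integrality behind "`(λ/16)^{1/N} ∈ t + t²ℤ[1/N]⟦t⟧`" in Calegari–Dimitrov–Tang's proof of
Proposition 15). [cite: CalegariDimitrovTang2025, §3, proof of Proposition 15 (display (xt))] -/
theorem exists_choose_div_natCast_eq_div_pow {N : ℕ} (hN : N ≠ 0) (a : ℤ) (k : ℕ) :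
    ∃ (m : ℕ) (z : ℤ), Ring.choose ((a : ℚ) / N) k = z / (N : ℚ) ^ m :=
  exists_eq_div_pow_of_forall_padicNorm_le_one hN fun p _ hpN ↦
    padicNorm_choose_div_natCast_le_one p hpN a k

/-! ### The binomial series `(1 + X)^{a/N}` -/

/-- The coefficients of the binomial series `(1 + X)^{a/N} = Σₖ C(a/N, k) Xᵏ` (Mathlib
`PowerSeries.binomialSeries ℚ (a/N)`) lie in `ℤ[1/N]`.
[cite: CalegariDimitrovTang2025, §3, proof of Proposition 15 (display (xt))] -/
theorem exists_coeff_binomialSeries_div_natCast_eq_div_pow {N : ℕ} (hN : N ≠ 0) (a : ℤ)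
    (n : ℕ) : ∃ (m : ℕ) (z : ℤ),
      coeff n (PowerSeries.binomialSeries ℚ ((a : ℚ) / N)) = z / (N : ℚ) ^ m := by
  rw [PowerSeries.binomialSeries_coeff, smul_eq_mul, mul_one]
  exact exists_choose_div_natCast_eq_div_pow hN a n

/-- `(1 + X)^{n • r} = ((1 + X)^r)ⁿ` for the formal binomial series over a binomial ring (iterate
Mathlib's `binomialSeries_add`). [folklore] -/
theorem binomialSeries_nsmul {R A : Type*} [CommRing R] [BinomialRing R] [CommRing A]
    [Algebra R A] (r : R) (n : ℕ) :
    PowerSeries.binomialSeries A (n • r) = PowerSeries.binomialSeries A r ^ n := by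
  induction n with
  | zero => simp
  | succ n ih => rw [succ_nsmul, PowerSeries.binomialSeries_add, ih, pow_succ]

/-- **`((1 + X)^{1/N})ᴺ = 1 + X`** for the formal binomial series with exponent `1/N ∈ ℚ`, `N ≠ 0`:
the series `(1 + X)^{1/N} ∈ ℤ[1/N]⟦X⟧` is an `N`-th root of `1 + X`.
[cite: CalegariDimitrovTang2025, §3, proof of Proposition 15 (display (xt))] -/
theorem binomialSeries_inv_natCast_pow {N : ℕ} (hN : N ≠ 0) :
    PowerSeries.binomialSeries ℚ ((N : ℚ)⁻¹) ^ N = (1 + PowerSeries.X : PowerSeries ℚ) := by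
  rw [← binomialSeries_nsmul, nsmul_eq_mul, mul_inv_cancel₀ (Nat.cast_ne_zero.mpr hN)]
  simpa using PowerSeries.binomialSeries_nat (R := ℚ) (A := ℚ) 1


/-! ### Kummer roots of `q + q² ℤ⟦q⟧` (CDT, proof of Proposition 15, display (xt)) -/

/-- **`N`-th roots of series in `q + q²ℤ⟦q⟧` have coefficients in `ℤ[1/N]`** — the formal content
of "`x := (λ(τ)/16)^{1/N} ∈ t + t² ℤ[1/N]⟦t⟧`" in Calegari–Dimitrov–Tang's proof of
Proposition 15 (display (xt)), where `λ/16 ∈ q + q²ℤ⟦q⟧` and `t = q^{1/N}`: for every `y ∈ ℤ⟦q⟧`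
and `N ≠ 0`, writing `x₀(q) = q (1 + q y(q))` for the general element of `q + q² ℤ⟦q⟧`, there is a
power series `x(t) ∈ t + t² ℤ[1/N]⟦t⟧` (every coefficient of the form `z / Nᵐ`, constant term `0`,
linear term `1`) with `x(t)ᴺ = x₀(tᴺ) = tᴺ (1 + tᴺ y(tᴺ))`; namely `x = t · (1 + tᴺ y(tᴺ))^{1/N}`
with the binomial series of `exists_coeff_binomialSeries_div_natCast_eq_div_pow`.
[cite: CalegariDimitrovTang2025, §3, proof of Proposition 15 (display (xt))] -/
theorem exists_root_series_of_mem_X_add_X_sq {N : ℕ} (hN : N ≠ 0) (y : PowerSeries ℤ) :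
    ∃ x : PowerSeries ℚ,
      (∀ n : ℕ, ∃ (m : ℕ) (z : ℤ), coeff n x = z / (N : ℚ) ^ m) ∧
      constantCoeff x = 0 ∧ coeff 1 x = 1 ∧
      x ^ N = (X : PowerSeries ℚ) ^ N *
        (1 + (X : PowerSeries ℚ) ^ N * expand N hN (y.map (Int.castRingHom ℚ))) := by
  classical
  have hNq : (N : ℚ) ≠ 0 := Nat.cast_ne_zero.mpr hN
  -- the subring `ℤ[1/N] ⊆ ℚ`, described as `{z / N ^ m}`
  let R : Subring ℚ :=
    { carrier := {q | ∃ (m : ℕ) (z : ℤ), q = z / (N : ℚ) ^ m}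
      mul_mem' := by
        rintro _ _ ⟨m, z, rfl⟩ ⟨m', z', rfl⟩
        refine ⟨m + m', z * z', ?_⟩
        push_cast
        rw [pow_add, div_mul_div_comm]
      one_mem' := ⟨0, 1, by simp⟩
      add_mem' := by
        rintro _ _ ⟨m, z, rfl⟩ ⟨m', z', rfl⟩
        refine ⟨m + m', z * N ^ m' + z' * N ^ m, ?_⟩
        push_cast
        rw [pow_add, div_add_div _ _ (pow_ne_zero m hNq) (pow_ne_zero m' hNq)]
        ring
      zero_mem' := ⟨0, 0, by simp⟩
      neg_mem' := by
        rintro _ ⟨m, z, rfl⟩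
        exact ⟨m, -z, by push_cast; ring⟩ }
  -- the binomial series `(1 + X)^{1/N}` with coefficients in `R`
  let B : PowerSeries R := PowerSeries.mk fun k ↦ ⟨Ring.choose ((N : ℚ)⁻¹) k, by
    obtain ⟨m, z, h⟩ := exists_choose_div_natCast_eq_div_pow hN 1 k
    refine ⟨m, z, ?_⟩
    rw [← h]
    push_cast
    rw [one_div]⟩
  have hBmap : B.map R.subtype = PowerSeries.binomialSeries ℚ ((N : ℚ)⁻¹) := by
    ext k
    simp [B, coeff_map]
  have hBN : B ^ N = 1 + X := by
    apply map_injective R.subtype Subtype.coe_injective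
    rw [map_pow, hBmap, binomialSeries_inv_natCast_pow hN, map_add, map_one, map_X]
  have hB0 : constantCoeff B = 1 := by
    rw [← coeff_zero_eq_constantCoeff_apply]
    ext
    simp [B]
  -- `u = X^N · y(X^N)` over `R`, and the root `x = X · B(u)`
  let yR : PowerSeries R := y.map (Int.castRingHom R)
  let u : PowerSeries R := X ^ N * expand N hN yR
  have hu0 : constantCoeff u = 0 := by
    simp [u, hN]
  have hu : HasSubst u := HasSubst.of_constantCoeff_zero' hu0
  let xR : PowerSeries R := X * B.subst u
  have hx1 : coeff 1 xR = 1 := by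
    rw [show (1 : ℕ) = 0 + 1 from rfl, coeff_succ_X_mul, coeff_subst' hu B 0,
      finsum_eq_single _ 0 fun d hd ↦ ?_]
    · rw [pow_zero, coeff_zero_eq_constantCoeff, map_one, hB0, one_smul]
    · rw [coeff_zero_eq_constantCoeff, map_pow, hu0, zero_pow hd, smul_zero]
  have hxN : xR ^ N = X ^ N * (1 + u) := by
    rw [mul_pow, ← subst_pow hu, hBN, ← coe_substAlgHom hu, map_add, map_one, substAlgHom_X]
  have hyR : yR.map R.subtype = y.map (Int.castRingHom ℚ) := by
    change ((map R.subtype).comp (map (Int.castRingHom R))) y = _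
    rw [← map_comp, RingHom.ext_int (R.subtype.comp (Int.castRingHom R)) (Int.castRingHom ℚ)]
  refine ⟨xR.map R.subtype, fun n ↦ ?_, ?_, ?_, ?_⟩
  · rw [coeff_map]
    exact (coeff n xR).2
  · rw [← coeff_zero_eq_constantCoeff_apply, coeff_map]
    simp [xR]
  · rw [coeff_map, hx1, map_one]
  · rw [← map_pow, hxN, map_mul, map_pow, map_X, map_add, map_one, map_mul, map_pow, map_X,
      map_expand, hyR]

end Literature.RingTheory.Binomial

end
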